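import Mathlib.MeasureTheory.Integral.Bochner.Basic
import Mathlib.MeasureTheory.Measure.Prod
import Mathlib.MeasureTheory.Constructions.BorelSpace.Metric
import Mathlib.MeasureTheory.Function.LocallyIntegrable
import Mathlib.Analysis.InnerProductSpace.PiL2
import Mathlib.MeasureTheory.Measure.Haar.OfBasis
import HarnessLib

/-!
# Tonelli bookkeeping for balls of a fixed radius (continuous Whitney decomposition, one scale)

Analysis/FluidPDE support file for the discharge of the named fact
`Literature.Analysis.FluidPDE.tao2011_nonlinearEstimate` (Tao 2011, §10, proof of Thm. 10.1,
estimate of `Y₆`, arXiv:1108.1165 p. 32: the "boundedly overlapping" Whitney balls). In our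
variant every bounded-overlap statement at a fixed scale `R` is the Tonelli identity

  `∫ A(y) (∫_{B̄(y,R)} Φ) dy = ∫ Φ(x) (∫_{B̄(x,R)} A) dx`   (`A, Φ ≥ 0` measurable)

(`lintegral_mul_setLIntegral_closedBall_comm`, in `ℝ≥0∞`), and its real-valued consequence
`integral_le_of_le_mul_setIntegral_closedBall`: if `0 ≤ f ≤ a · (∫_{B̄(·,R)} φ)` pointwise with
`a, φ ≥ 0`, the masses `∫_{B̄(x,R)} a ≤ M` are uniformly bounded, and `a` vanishes at distance
`> R` from the complement of a measurable set `N`, then `∫ f ≤ M ∫_N φ`.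

## References

* T. Tao, arXiv:1108.1165 (`Tao2011`), §10, proof of Thm. 10.1, p. 32.
-/

noncomputable section

open MeasureTheory Set Filter Metric Function
open scoped ENNReal NNReal

namespace Literature.Analysis.FluidPDE.TaoY6

variable {E : Type*} [MeasurableSpace E] [MetricSpace E] [OpensMeasurableSpace E]
  {μ : Measure E} [SFinite μ]

/-- The kernel `(y, x) ↦ 1[dist x y ≤ R] Φ(x)` is measurable on the product. [folklore] -/
theorem measurable_indicator_closedBall_comp [SecondCountableTopology E] {Φ : E → ℝ≥0∞}
    (hΦ : Measurable Φ) (R : ℝ) :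
    Measurable fun p : E × E => (closedBall p.1 R).indicator Φ p.2 := by
  have hset : MeasurableSet {p : E × E | dist p.2 p.1 ≤ R} :=
    measurableSet_le (continuous_dist.comp (continuous_snd.prodMk continuous_fst)).measurable
      measurable_const
  have heq : (fun p : E × E => (closedBall p.1 R).indicator Φ p.2) =
      {p : E × E | dist p.2 p.1 ≤ R}.indicator (Φ ∘ Prod.snd) := by
    funext p
    simp only [indicator, mem_closedBall, mem_setOf_eq, comp_apply]
  rw [heq]
  exact (hΦ.comp measurable_snd).indicator hset

/-- **Tonelli for ball neighbourhoods of a fixed radius**: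
`∫ A(y) (∫_{B̄(y,R)} Φ) dy = ∫ Φ(x) (∫_{B̄(x,R)} A) dx` for measurable `A, Φ ≥ 0`. [folklore] -/
theorem lintegral_mul_setLIntegral_closedBall_comm [SecondCountableTopology E] {A Φ : E → ℝ≥0∞}
    (hA : Measurable A) (hΦ : Measurable Φ) (R : ℝ) :
    ∫⁻ y, A y * ∫⁻ x in closedBall y R, Φ x ∂μ ∂μ = ∫⁻ x, Φ x * ∫⁻ y in closedBall x R, A y ∂μ ∂μ := by
  have h1 : ∀ y, A y * ∫⁻ x in closedBall y R, Φ x ∂μ =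
      ∫⁻ x, A y * (closedBall y R).indicator Φ x ∂μ := fun y => by
    rw [← lintegral_indicator measurableSet_closedBall, lintegral_const_mul _ (hΦ.indicator
      measurableSet_closedBall)]
  have h2 : ∀ x, Φ x * ∫⁻ y in closedBall x R, A y ∂μ =
      ∫⁻ y, A y * (closedBall y R).indicator Φ x ∂μ := fun x => by
    rw [← lintegral_indicator measurableSet_closedBall, ← lintegral_const_mul _ (hA.indicator
      measurableSet_closedBall)]
    refine lintegral_congr fun y => ?_
    by_cases hy : y ∈ closedBall x R
    · have hx : x ∈ closedBall y R := by rw [mem_closedBall, dist_comm]; exact mem_closedBall.1 hy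
      rw [indicator_of_mem hy, indicator_of_mem hx, mul_comm]
    · have hx : x ∉ closedBall y R := fun h => hy (by
        rw [mem_closedBall, dist_comm]; exact mem_closedBall.1 h)
      rw [indicator_of_notMem hy, indicator_of_notMem hx, mul_zero, mul_zero]
  simp_rw [h1, h2]
  exact lintegral_lintegral_swap ((hA.comp measurable_fst).mul
    (measurable_indicator_closedBall_comp hΦ R)).aemeasurable

omit [SFinite μ] in
/-- Off the `R`-neighbourhood of the support of `a`, the ball masses of `a` vanish: if every
point of `tsupport a` is at distance `> R` from `x`, then `∫_{B̄(x,R)} a = 0`. [folklore] -/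
theorem setLIntegral_closedBall_eq_zero_of_dist {a : E → ℝ≥0∞} {x : E} {R : ℝ}
    (hx : ∀ y ∈ tsupport a, R < dist y x) : ∫⁻ y in closedBall x R, a y ∂μ = 0 := by
  have h : EqOn a (fun _ => 0) (closedBall x R) := fun y hy =>
    image_eq_zero_of_notMem_tsupport fun hy' => (not_lt.2 (mem_closedBall.1 hy)) (hx y hy')
  rw [setLIntegral_congr_fun measurableSet_closedBall h, lintegral_zero]

/-- **Overlap bound at a fixed scale** (real-valued form of the Tonelli identity): let
`0 ≤ f ≤ a · ∫_{B̄(·,R)} φ` pointwise with `a, φ ≥ 0` continuous, suppose the ball masses of `a`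
are bounded, `∫_{B̄(x,R)} a ≤ M`, and that `a` is supported at distance `> R` from the complement
of a measurable set `N` on which `φ` is integrable. Then `∫ f ≤ M ∫_N φ`. [folklore] -/
theorem integral_le_of_le_mul_setIntegral_closedBall [SecondCountableTopology E] [ProperSpace E]
    [BorelSpace E] [IsLocallyFiniteMeasure μ] {f a φ : E → ℝ} (hf0 : ∀ y, 0 ≤ f y)
    (hfm : AEStronglyMeasurable f μ) (ha0 : ∀ y, 0 ≤ a y) (hac : Continuous a)
    (hφ0 : ∀ x, 0 ≤ φ x) (hφc : Continuous φ) {R M : ℝ} (hM0 : 0 ≤ M)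
    (hpt : ∀ y, f y ≤ a y * ∫ x in closedBall y R, φ x ∂μ)
    (hM : ∀ x, ∫ y in closedBall x R, a y ∂μ ≤ M) {N : Set E} (hN : MeasurableSet N)
    (hNa : ∀ x ∉ N, ∀ y ∈ tsupport a, R < dist y x) (hφN : IntegrableOn φ N μ) :
    ∫ y, f y ∂μ ≤ M * ∫ x in N, φ x ∂μ := by
  have ham : Measurable fun y => ENNReal.ofReal (a y) := ENNReal.measurable_ofReal.comp hac.measurable
  have hφm : Measurable fun x => ENNReal.ofReal (φ x) := ENNReal.measurable_ofReal.comp hφc.measurable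
  -- ball integrals of the continuous `a`, `φ` as lintegrals
  have hballφ : ∀ y, ENNReal.ofReal (∫ x in closedBall y R, φ x ∂μ) =
      ∫⁻ x in closedBall y R, ENNReal.ofReal (φ x) ∂μ := fun y =>
    ofReal_integral_eq_lintegral_ofReal
      (hφc.continuousOn.integrableOn_compact (isCompact_closedBall y R))
      (Eventually.of_forall fun x => hφ0 x)
  have hballa : ∀ x, ENNReal.ofReal (∫ y in closedBall x R, a y ∂μ) =
      ∫⁻ y in closedBall x R, ENNReal.ofReal (a y) ∂μ := fun x =>
    ofReal_integral_eq_lintegral_ofReal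
      (hac.continuousOn.integrableOn_compact (isCompact_closedBall x R))
      (Eventually.of_forall fun y => ha0 y)
  have hIN : 0 ≤ ∫ x in N, φ x ∂μ := integral_nonneg fun x => hφ0 x
  -- the chain of inequalities in `ℝ≥0∞`
  have hchain : ∫⁻ y, ENNReal.ofReal (f y) ∂μ ≤ ENNReal.ofReal (M * ∫ x in N, φ x ∂μ) := by
    calc ∫⁻ y, ENNReal.ofReal (f y) ∂μ
        ≤ ∫⁻ y, ENNReal.ofReal (a y) * ∫⁻ x in closedBall y R, ENNReal.ofReal (φ x) ∂μ ∂μ := by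
          refine lintegral_mono fun y => ?_
          rw [← hballφ, ← ENNReal.ofReal_mul (ha0 y)]
          exact ENNReal.ofReal_le_ofReal (hpt y)
      _ = ∫⁻ x, ENNReal.ofReal (φ x) * ∫⁻ y in closedBall x R, ENNReal.ofReal (a y) ∂μ ∂μ :=
          lintegral_mul_setLIntegral_closedBall_comm ham hφm R
      _ ≤ ∫⁻ x, ENNReal.ofReal (φ x) * N.indicator (fun _ => ENNReal.ofReal M) x ∂μ := by
          refine lintegral_mono fun x => mul_le_mul' le_rfl ?_
          by_cases hxN : x ∈ N
          · rw [indicator_of_mem hxN, ← hballa]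
            exact ENNReal.ofReal_le_ofReal (hM x)
          · rw [indicator_of_notMem hxN]
            have h0 : ∫⁻ y in closedBall x R, ENNReal.ofReal (a y) ∂μ = 0 := by
              refine setLIntegral_closedBall_eq_zero_of_dist fun y hy => hNa x hxN y ?_
              exact (tsupport_comp_subset ENNReal.ofReal_zero a) hy
            rw [h0]
      _ = ENNReal.ofReal M * ∫⁻ x in N, ENNReal.ofReal (φ x) ∂μ := by
          rw [← lintegral_indicator hN, ← lintegral_const_mul _ (hφm.indicator hN)]
          refine lintegral_congr fun x => ?_
          by_cases hxN : x ∈ N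
          · rw [indicator_of_mem hxN, indicator_of_mem hxN, mul_comm]
          · rw [indicator_of_notMem hxN, indicator_of_notMem hxN, mul_zero, mul_zero]
      _ = ENNReal.ofReal (M * ∫ x in N, φ x ∂μ) := by
          rw [ENNReal.ofReal_mul hM0, ofReal_integral_eq_lintegral_ofReal hφN
            (Eventually.of_forall fun x => hφ0 x)]
  rw [integral_eq_lintegral_of_nonneg_ae (Eventually.of_forall hf0) hfm]
  have := ENNReal.toReal_mono ENNReal.ofReal_ne_top hchain
  rwa [ENNReal.toReal_ofReal (mul_nonneg hM0 hIN)] at this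

end Literature.Analysis.FluidPDE.TaoY6

end
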